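import Mathlib
import Summits.CriticalPhenomena.CardyFormulaZ2.Theorems.CardyMagicRigidityPositiveConeDefs
import Summits.CriticalPhenomena.CardyFormulaZ2.Theorems.CardyMagicRigidityNestingRigidityConeTiltLoopSide
import Summits.CriticalPhenomena.CardyFormulaZ2.Theorems.CardyMagicRigidityNestingRigidityStaircaseCloud
import Summits.CriticalPhenomena.CardyFormulaZ2.Theorems.CardyMagicRigidityNestingRigidityTowerCountMeasurable
import HarnessLib

/-!
# Crux `NestingRigidity`, line `ring-cloud-tomography` (r4): the FUSION CLOUD on the loop side —
# multi-disc pattern decomposition of the loop functional on BOTH lattices (stub R5' `stub_fusionTilt`)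

Crux `Summit.CriticalPhenomena.CardyFormulaZ2.Theses.CardyMagicRigidity.NestingRigidity`
(stmt-CriticalPhenomena-4835), line `ring-cloud-tomography`, skeleton r4, stub R5' `stub_fusionTilt` (the
`n ≥ 2` fusion step).  Every fusion argument feeds the cloud law with the FUSION CLOUD of a disc family
`B̄(z i, r i)`, `i : Fin n`, of charges `a i`, all in the hole of ONE neutralising ring (centre `0`, radii
`L < M`, charge `−Σ_i a i`): the `Cloud` literal `Cloud.mk n 1 z r a (fun _ ↦ 0) (fun _ ↦ L) (fun _ ↦ M)
(fun _ ↦ -∑ i, a i)` (pinned to `𝔠` by `h𝔠` in §2–§4; instantiate with `rfl`) — the multi-disc sibling of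
`…ConeTiltLoopSide` (one bump: `A = w(t)^{N_0(r,1)} · rest`).  Deterministic, proved, no cited facts, no
definitions:
* §1 ABSTRACT MULTI-FAMILY FACTORISATION of a `finprod`: pairwise disjoint finite families `T k ⊆ A` of
  constant weight `w k` give `∏ᶠ_A g = (∏_k w_k^{#T k}) · ∏ᶠ_{A ∖ ⋃ T k} g` (`finprod_mem_eq_prod_pow_mul`);
* §2 the fusion cloud is ADMISSIBLE (`0 < r i`, `r i + r j ≤ ‖z i − z j‖`, `‖z i‖ + r i ≤ L`, `0 < L < M`),
  its density vanishes off `B̄(0, M)` and has mean zero; BITE FORMULA `θ_u = Σ_i a_i φ_i(u) − (Σ_i a_i) ψ(u)`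
  (carrier fractions in `[0, 1]`, `ConeTilt.nestingPhase_density`); explicit energy (the Gaussian side
  under the cloud law of `E` is then `hE 𝔠 (FusionCloud.admissible rfl …)`);
* §3 THE PATTERN DECOMPOSITION (the content): a loop with trace in the window `B(0, L)` never bites the
  ring; if it is a PATTERN LOOP — every closed disc inside its winding interior (`i ∈ S`) or off
  interior-and-trace (`i ∉ S`): the predicate of `patternCount c z r L S` — its phase is EXACTLY
  `Σ_{i∈S} a_i` and its weight `w_S = magicWeight (Σ_{i∈S} a_i)` (`w_∅ = 1`); the pattern loops are
  partitioned by `S`, whence for every configuration with finitely many loops meeting `B̄(0, M)`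
  `A_𝔠(c) = (∏_{S ≠ ∅} w_S^{N_S}) · ∏ᶠ_{u not a pattern loop of the window} w_u` (`nestingWeight_eq`), and so
  on BOTH lattice ensembles at every mesh `δ > 0` (registered: `nestingWeight_fusionCloud_eq_latticeEnsembles`);
* §4 FUSION POSITIVITY: every phase lies in `[−N, P]`, `P = Σ_i a_i⁺ + (−Σ_i a_i)⁺` / `N = Σ_i a_i⁻ + (Σ_i a_i)⁺`
  the total positive / negative charge; `P ≤ π/6`, `N ≤ 5π/6` (e.g. `Σ_i |a_i| ≤ π/6`) make EVERY loop
  weight, every partial product and `A_𝔠` itself `≥ 0`: the fusion tilt is an honest non-negative functional;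
* §5 on both lattices the pattern counts are deterministically bounded at mesh `δ > 0`, so the tilted
  pattern moment `E_δ[∏_{S ≠ ∅} u_S^{N_S}]` is an honest integral for ALL weights `u_S ≥ 0`.
What R5' needs beyond this is analytic (fusion ratios against the one-disc identities, the `η`-squeeze of
the tied band, multivariable Laplace uniqueness) plus the loop-side decoupling of R1'/R2'/R4'; none of it
is asserted here.
-/

noncomputable section

open MeasureTheory Set Filter Metric
open scoped Real Topology BigOperators

namespace Summit.CriticalPhenomena.CardyFormulaZ2.Cruxes.NestingRigidity.RingCloudTomography

open Literature.Probability.RandomPlanarGeometry Literature.Probability.Percolation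
  Literature.Probability.LatticeModels
open Summit.CriticalPhenomena.CardyFormulaZ2.Cruxes.NestingRigidity.PositiveConeWeightDoubling
  (magicWeight magicWeight_zero nonemptyParts)

namespace FusionCloud

/-! ## §1 An abstract multi-family factorisation of a `finprod` -/

/-- **Abstract pattern factorisation.** In a commutative monoid, if `g` has finite multiplicative
support on `A` and `T k ⊆ A` (`k` in a finite index type) are pairwise disjoint finite families on
each of which `g` is the constant `w k`, then
`∏ᶠ_{u ∈ A} g u = (∏_k w_k^{#T k}) · ∏ᶠ_{u ∈ A ∖ ⋃_k T k} g u` (honest finite products throughout). -/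
theorem finprod_mem_eq_prod_pow_mul {α ι N : Type*} [CommMonoid N] [Fintype ι] {A : Set α}
    {g : α → N} (hms : (A ∩ Function.mulSupport g).Finite) {T : ι → Set α} {w : ι → N}
    (hT : ∀ k, T k ⊆ A) (hTfin : ∀ k, (T k).Finite) (hdisj : Pairwise (Function.onFun Disjoint T))
    (hw : ∀ k, ∀ u ∈ T k, g u = w k) :
    ∏ᶠ u ∈ A, g u = (∏ k, w k ^ (T k).ncard) * ∏ᶠ u ∈ A \ ⋃ k, T k, g u := by
  have hU : (⋃ k, T k) ⊆ A := Set.iUnion_subset hT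
  have hUfin : (⋃ k, T k).Finite := Set.finite_iUnion hTfin
  have key : ∏ᶠ u ∈ A, g u = (∏ᶠ u ∈ ⋃ k, T k, g u) * ∏ᶠ u ∈ A \ ⋃ k, T k, g u := by
    rw [← finprod_mem_union' Set.disjoint_sdiff_right (hUfin.inter_of_left _)
      (hms.subset (Set.inter_subset_inter_left _ Set.sdiff_subset)), Set.union_sdiff_cancel hU]
  rw [key, finprod_mem_iUnion hdisj hTfin, finprod_eq_prod_of_fintype]
  congr 1
  refine Finset.prod_congr rfl fun k _ ↦ ?_
  rw [finprod_mem_congr rfl (hw k), finprod_mem_eq_finite_toFinset_prod _ (hTfin k),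
    Finset.prod_const, Set.ncard_eq_toFinset_card _ (hTfin k)]

/-- A closed disc (radius `≥ 0`) is not both inside a set and off a superset of it. -/
theorem false_of_subset_of_disjoint {x : ℂ} {ρ : ℝ} (hρ : 0 ≤ ρ) {U V : Set ℂ}
    (h₁ : closedBall x ρ ⊆ U) (h₂ : Disjoint (closedBall x ρ) (U ∪ V)) : False :=
  Set.disjoint_left.1 h₂ (mem_closedBall_self hρ) (Or.inl (h₁ (mem_closedBall_self hρ)))

/-- A loop with trace in `B(0, L)` does not bite a ring of inner radius `L` about the origin. -/
theorem setIntegral_annulusDensity_eq_zero_of_range_subset {u : UnbasedLoop ℂ} {L : ℝ}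
    (hu : u.range ⊆ ball (0 : ℂ) L) (M : ℝ) :
    ∫ w in {w | u.wind w ≠ 0}, annulusDensity 0 L M w = 0 :=
  ConeTilt.setIntegral_annulusDensity_eq_zero 0 L M (Set.disjoint_left.2 fun _ hw hw' ↦
    hw (Staircase.wind_eq_zero_of_range_subset_ball hu (by simpa using hw'.1)))

/-! ## §2 The fusion cloud `𝔠` (pinned by `h𝔠`; instantiate with `rfl`) -/

section Fusion

variable {𝔠 : Cloud} {n : ℕ} {z : Fin n → ℂ} {r a : Fin n → ℝ} {L M : ℝ}
  (h𝔠 : 𝔠 = Cloud.mk n 1 z r a (fun _ ↦ 0) (fun _ ↦ L) (fun _ ↦ M) (fun _ ↦ -∑ i, a i))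
include h𝔠

/-- **The fusion cloud is admissible** as soon as the discs have positive radii, are pairwise
disjoint (tangency allowed) and sit in the hole `‖z i‖ + r i ≤ L` of the ring `0 < L < M`. -/
theorem admissible (hr : ∀ i, 0 < r i) (hsep : ∀ i j, i ≠ j → r i + r j ≤ ‖z i - z j‖)
    (hzL : ∀ i, ‖z i‖ + r i ≤ L) (hL : 0 < L) (hLM : L < M) : 𝔠.Admissible := by
  subst h𝔠
  exact ⟨hr, fun _ ↦ hL, fun _ ↦ hLM, by simp, hsep, fun i _ ↦ Or.inl (by simpa using hzL i),
    fun k l hkl ↦ absurd (Subsingleton.elim k l) hkl⟩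

/-- The fusion density vanishes off `B̄(0, M)` (discs in the hole, `L ≤ M`) … -/
theorem density_eq_zero (hzL : ∀ i, ‖z i‖ + r i ≤ L) (hLM : L ≤ M) {w : ℂ} (hw : M < ‖w‖) :
    𝔠.density w = 0 := by
  subst h𝔠
  simp only [Cloud.density, Fin.sum_univ_one]
  rw [Finset.sum_eq_zero fun i _ ↦ ?_, CloudAdmissibility.annulusDensity_eq_zero
    (by rw [sub_zero]; exact hw.le), mul_zero, add_zero]
  rw [CloudAdmissibility.discDensity_eq_zero ?_, mul_zero]
  linarith [hzL i, norm_sub_norm_le w (z i)]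

/-- … and has mean zero (`0 < r i`, `0 < L < M`; the disjointness of the discs is not needed). -/
theorem integral_density (hr : ∀ i, 0 < r i) (hL : 0 < L) (hLM : L < M) : ∫ w, 𝔠.density w = 0 := by
  subst h𝔠
  have h1 : ∀ i, Integrable (fun w ↦ a i * discDensity (z i) (r i) w) := fun i ↦
    (CloudAdmissibility.integrable_discDensity _ _).const_mul _
  have h2 : Integrable (fun w ↦ (-∑ i, a i) * annulusDensity 0 L M w) :=
    (CloudAdmissibility.integrable_annulusDensity _ _ _).const_mul _
  simp only [Cloud.density, Fin.sum_univ_one]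
  rw [integral_add (integrable_finsetSum _ fun i _ ↦ h1 i) h2, integral_finsetSum _ fun i _ ↦ h1 i]
  simp only [integral_const_mul, CloudAdmissibility.integral_discDensity _ (hr _),
    CloudAdmissibility.integral_annulusDensity _ hL hLM, mul_one, add_neg_cancel]

/-- **Bite formula for the fusion cloud**: the phase of any loop is `Σ_i a_i φ_i − (Σ_i a_i) ψ`,
`φ_i` the fraction of disc `i` and `ψ` the fraction of the ring inside the winding interior. -/
theorem nestingPhase_eq (u : UnbasedLoop ℂ) :
    u.nestingPhase 𝔠.density =
      ∑ i, a i * (∫ w in {w | u.wind w ≠ 0}, discDensity (z i) (r i) w) -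
        (∑ i, a i) * ∫ w in {w | u.wind w ≠ 0}, annulusDensity 0 L M w := by
  subst h𝔠; rw [ConeTilt.nestingPhase_density]; simp only [Fin.sum_univ_one]; ring

/-- **The Gaussian exponent of the fusion cloud**: the Coulomb energy of the discs (self `a_i²(log r_i − 1/4)`,
pairs `a_i a_j log‖z_i − z_j‖`) plus two ring terms in the TOTAL charge only (discs sit in the hole). -/
theorem energy_eq (hzL : ∀ i, ‖z i‖ + r i ≤ L) :
    𝔠.energy = (∑ i, ∑ j, a i * a j *
        (if i = j then discSelfEnergy (r i) else Real.log ‖z i - z j‖)) +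
      2 * (∑ i, a i * (-∑ j, a j) * ringHolePotential L M) +
        (-∑ i, a i) * (-∑ i, a i) * ringSelfEnergy L M := by
  subst h𝔠
  simp only [Cloud.energy, Fin.sum_univ_one, sub_zero, hzL, if_true]

/-! ## §3 The pattern decomposition -/

/-- An inner loop (trace in the window `B(0, L)`) never bites the ring: its phase is `Σ_i a_i φ_i`. -/
theorem nestingPhase_of_range_subset {u : UnbasedLoop ℂ} (hu : u.range ⊆ ball (0 : ℂ) L) :
    u.nestingPhase 𝔠.density = ∑ i, a i * ∫ w in {w | u.wind w ≠ 0}, discDensity (z i) (r i) w := by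
  rw [nestingPhase_eq h𝔠, setIntegral_annulusDensity_eq_zero_of_range_subset hu, mul_zero, sub_zero]

/-- **Pattern loops carry exactly the surrounded charge.** An inner loop for which every disc
`B̄(z i, r i)` is inside the winding interior (`i ∈ S`, fraction `1`) or off interior-and-trace
(`i ∉ S`, fraction `0`) — the predicate counted by `patternCount c z r L S` — has phase `Σ_{i ∈ S} a_i` … -/
theorem nestingPhase_of_pattern (hr : ∀ i, 0 < r i) {u : UnbasedLoop ℂ}
    (hu : u.range ⊆ ball (0 : ℂ) L) {S : Finset (Fin n)}
    (hin : ∀ i ∈ S, closedBall (z i) (r i) ⊆ {w | u.wind w ≠ 0})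
    (hout : ∀ i, i ∉ S → Disjoint (closedBall (z i) (r i)) ({w | u.wind w ≠ 0} ∪ u.range)) :
    u.nestingPhase 𝔠.density = ∑ i ∈ S, a i := by
  classical
  rw [nestingPhase_of_range_subset h𝔠 hu]
  have key : ∀ i, a i * ∫ w in {w | u.wind w ≠ 0}, discDensity (z i) (r i) w =
      if i ∈ S then a i else 0 := fun i ↦ by
    split_ifs with hi
    · rw [ConeTilt.setIntegral_discDensity_eq_one (z i) (hr i)
        (ball_subset_closedBall.trans (hin i hi)), mul_one]
    · rw [ConeTilt.setIntegral_discDensity_eq_zero (z i) (r i)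
        (((hout i hi).mono_right Set.subset_union_left).symm.mono_right ball_subset_closedBall),
        mul_zero]
  simp_rw [key]
  rw [Finset.sum_ite_mem, Finset.univ_inter]

/-- … hence weight `w_S = magicWeight (Σ_{i ∈ S} a_i)`. -/
theorem nestingFactor_of_pattern (hr : ∀ i, 0 < r i) {u : UnbasedLoop ℂ}
    (hu : u.range ⊆ ball (0 : ℂ) L) {S : Finset (Fin n)}
    (hin : ∀ i ∈ S, closedBall (z i) (r i) ⊆ {w | u.wind w ≠ 0})
    (hout : ∀ i, i ∉ S → Disjoint (closedBall (z i) (r i)) ({w | u.wind w ≠ 0} ∪ u.range)) :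
    u.nestingFactor 𝔠.density = magicWeight (∑ i ∈ S, a i) := by
  rw [UnbasedLoop.nestingFactor, nestingPhase_of_pattern h𝔠 hr hu hin hout, magicWeight]

/-- **THE PATTERN DECOMPOSITION of the fusion functional** (configuration level). If finitely many
loops of `c` meet `B̄(0, M)`, then `A_𝔠(c) = (∏_{S ≠ ∅} w_S^{N_S}) · ∏ᶠ_{u ∈ c.loops ∖ Pattern} w_u` with
`w_S = magicWeight (Σ_{i∈S} a_i)`, `N_S = patternCount c z r L S` and `Pattern` the pattern loops of the
window `B(0, L)` (each disc inside the interior or off interior-and-trace; the class `S = ∅` weighs `1`);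
the remaining loops leave the window or bite some disc partially (UV loops). -/
theorem nestingWeight_eq (hr : ∀ i, 0 < r i) (hzL : ∀ i, ‖z i‖ + r i ≤ L) (hL : 0 < L) (hLM : L < M)
    {c : LoopConfig ℂ} (hfin : {u ∈ c.loops | (u.range ∩ closedBall (0 : ℂ) M).Nonempty}.Finite) :
    c.nestingWeight 𝔠.density =
      (∏ S ∈ nonemptyParts n, magicWeight (∑ i ∈ S, a i) ^ patternCount c z r L S) *
        ∏ᶠ u ∈ c.loops \ {u ∈ c.loops | u.range ⊆ ball (0 : ℂ) L ∧
            ∀ i, closedBall (z i) (r i) ⊆ {w | u.wind w ≠ 0} ∨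
              Disjoint (closedBall (z i) (r i)) ({w | u.wind w ≠ 0} ∪ u.range)},
          u.nestingFactor 𝔠.density := by
  classical
  -- the pattern classes, indexed by the surrounded set `S`
  set T : Finset (Fin n) → Set (UnbasedLoop ℂ) := fun S ↦ {u ∈ c.loops | u.range ⊆ ball (0 : ℂ) L ∧
    (∀ i ∈ S, closedBall (z i) (r i) ⊆ {w | u.wind w ≠ 0}) ∧
    ∀ i, i ∉ S → Disjoint (closedBall (z i) (r i)) ({w | u.wind w ≠ 0} ∪ u.range)} with hT
  have hms : (c.loops ∩ Function.mulSupport fun u : UnbasedLoop ℂ ↦ u.nestingFactor 𝔠.density).Finite :=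
    hfin.subset fun u hu ↦ ⟨hu.1, range_inter_closedBall_nonempty_of_nestingFactor_ne_one
      (fun w hw ↦ density_eq_zero h𝔠 hzL hLM.le hw) (integral_density h𝔠 hr hL hLM) hu.2⟩
  have hTsub : ∀ S, T S ⊆ c.loops := fun S u hu ↦ hu.1
  have hTfin : ∀ S, (T S).Finite := fun S ↦ hfin.subset fun u hu ↦ ⟨hu.1, by
    obtain ⟨p, hp⟩ := u.range_nonempty
    exact ⟨p, hp, mem_closedBall_zero_iff.2 ((mem_ball_zero_iff.1 (hu.2.1 hp)).le.trans hLM.le)⟩⟩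
  have hdisj : Pairwise (Function.onFun Disjoint T) := fun S S' hne ↦
    Set.disjoint_left.2 fun u hu hu' ↦ hne (Finset.ext fun i ↦
      ⟨fun hi ↦ by_contra fun hi' ↦ false_of_subset_of_disjoint (hr i).le (hu.2.2.1 i hi)
        (hu'.2.2.2 i hi'),
      fun hi' ↦ by_contra fun hi ↦ false_of_subset_of_disjoint (hr i).le (hu'.2.2.1 i hi')
        (hu.2.2.2 i hi)⟩)
  have hw : ∀ S, ∀ u ∈ T S, u.nestingFactor 𝔠.density = magicWeight (∑ i ∈ S, a i) :=
    fun S u hu ↦ nestingFactor_of_pattern h𝔠 hr hu.2.1 hu.2.2.1 hu.2.2.2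
  have hU : {u ∈ c.loops | u.range ⊆ ball (0 : ℂ) L ∧
      ∀ i, closedBall (z i) (r i) ⊆ {w | u.wind w ≠ 0} ∨
        Disjoint (closedBall (z i) (r i)) ({w | u.wind w ≠ 0} ∪ u.range)} = ⋃ S, T S := by
    ext u
    simp only [Set.mem_iUnion, Set.mem_setOf_eq, hT]
    constructor
    · rintro ⟨hu, hball, hpat⟩
      refine ⟨Finset.univ.filter fun i ↦ closedBall (z i) (r i) ⊆ {w | u.wind w ≠ 0}, hu, hball,
        fun i hi ↦ (Finset.mem_filter.1 hi).2, fun i hi ↦ (hpat i).resolve_left fun h ↦ hi ?_⟩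
      exact Finset.mem_filter.2 ⟨Finset.mem_univ _, h⟩
    · rintro ⟨S, hu, hball, hin, hout⟩
      exact ⟨hu, hball, fun i ↦ if hi : i ∈ S then Or.inl (hin i hi) else Or.inr (hout i hi)⟩
  -- the class `S = ∅` weighs `w(0)^{N_∅} = 1`
  have hne : ∀ S ∈ (Finset.univ : Finset (Finset (Fin n))),
      magicWeight (∑ i ∈ S, a i) ^ patternCount c z r L S ≠ 1 → S.Nonempty := fun S _ hS ↦
    Finset.nonempty_iff_ne_empty.2 fun h ↦ hS (by rw [h, Finset.sum_empty, magicWeight_zero, one_pow])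
  rw [LoopConfig.nestingWeight, finprod_mem_eq_prod_pow_mul hms hTsub hTfin hdisj hw, hU]
  congr 1
  calc ∏ S, magicWeight (∑ i ∈ S, a i) ^ (T S).ncard
      = ∏ S, magicWeight (∑ i ∈ S, a i) ^ patternCount c z r L S := rfl
    _ = _ := (Finset.prod_filter_of_ne hne).symm

/-! ## §4 Fusion positivity -/

omit h𝔠 in
/-- `a x ≤ a⁺` for `x ∈ [0, 1]`. -/
theorem mul_le_max_of_mem_Icc (b : ℝ) {x : ℝ} (hx : x ∈ Set.Icc (0 : ℝ) 1) : b * x ≤ max b 0 := by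
  nlinarith [le_max_left b 0, le_max_right b 0, hx.1, hx.2]

omit h𝔠 in
/-- `−a⁻ ≤ a x` for `x ∈ [0, 1]`. -/
theorem neg_max_le_mul_of_mem_Icc (b : ℝ) {x : ℝ} (hx : x ∈ Set.Icc (0 : ℝ) 1) :
    -max (-b) 0 ≤ b * x := by
  nlinarith [le_max_left (-b) 0, le_max_right (-b) 0, hx.1, hx.2]

/-- **Phase window of the fusion cloud**: EVERY loop has phase in `[−N, P]`, `P = Σ_i a_i⁺ + (−Σ_i a_i)⁺`
the total positive and `N = Σ_i a_i⁻ + (Σ_i a_i)⁺` the total negative charge (bites fill `[0, 1]^{n+1}`). -/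
theorem nestingPhase_mem_Icc (hr : ∀ i, 0 < r i) (hL : 0 < L) (hLM : L < M) (u : UnbasedLoop ℂ) :
    u.nestingPhase 𝔠.density ∈
      Set.Icc (-(∑ i, max (-a i) 0 + max (∑ i, a i) 0)) (∑ i, max (a i) 0 + max (-∑ i, a i) 0) := by
  rw [nestingPhase_eq h𝔠]
  set φ : Fin n → ℝ := fun i ↦ ∫ w in {w | u.wind w ≠ 0}, discDensity (z i) (r i) w
  set ψ : ℝ := ∫ w in {w | u.wind w ≠ 0}, annulusDensity 0 L M w
  have h₀ : ∀ i, φ i ∈ Set.Icc (0 : ℝ) 1 := fun i ↦ ConeTilt.setIntegral_discDensity_mem_Icc (z i) (hr i) _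
  have h₁ : ψ ∈ Set.Icc (0 : ℝ) 1 := ConeTilt.setIntegral_annulusDensity_mem_Icc 0 hL hLM _
  have h₂ : ∑ i, a i * φ i ≤ ∑ i, max (a i) 0 :=
    Finset.sum_le_sum fun i _ ↦ mul_le_max_of_mem_Icc (a i) (h₀ i)
  have h₃ : -∑ i, max (-a i) 0 ≤ ∑ i, a i * φ i := by
    rw [← Finset.sum_neg_distrib]
    exact Finset.sum_le_sum fun i _ ↦ neg_max_le_mul_of_mem_Icc (a i) (h₀ i)
  have h₄ : (-∑ i, a i) * ψ ≤ max (-∑ i, a i) 0 := mul_le_max_of_mem_Icc _ h₁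
  have h₅ : -max (∑ i, a i) 0 ≤ (-∑ i, a i) * ψ := by
    simpa only [neg_neg] using neg_max_le_mul_of_mem_Icc (-∑ i, a i) h₁
  constructor <;> linarith

/-- **Fusion positivity.** If the total positive charge `P ≤ π/6` and the total negative charge
`N ≤ 5π/6`, EVERY loop weight `2cos(θ_u + π/3)` against the fusion cloud is `≥ 0` … -/
theorem nestingFactor_nonneg (hr : ∀ i, 0 < r i) (hL : 0 < L) (hLM : L < M)
    (hP : ∑ i, max (a i) 0 + max (-∑ i, a i) 0 ≤ π / 6)
    (hN : ∑ i, max (-a i) 0 + max (∑ i, a i) 0 ≤ 5 * π / 6) (u : UnbasedLoop ℂ) :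
    0 ≤ u.nestingFactor 𝔠.density := by
  have h := nestingPhase_mem_Icc h𝔠 hr hL hLM u
  exact Staircase.magicWeight_nonneg_of_mem_Icc ⟨by linarith [h.1], by linarith [h.2]⟩

/-- … hence every partial product of weights (e.g. the non-pattern factor of `nestingWeight_eq`) … -/
theorem finprod_mem_nonneg (hr : ∀ i, 0 < r i) (hL : 0 < L) (hLM : L < M)
    (hP : ∑ i, max (a i) 0 + max (-∑ i, a i) 0 ≤ π / 6)
    (hN : ∑ i, max (-a i) 0 + max (∑ i, a i) 0 ≤ 5 * π / 6) (W : Set (UnbasedLoop ℂ)) :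
    0 ≤ ∏ᶠ u ∈ W, u.nestingFactor 𝔠.density :=
  finprod_mem_induction (fun x ↦ 0 ≤ x) zero_le_one (fun _ _ ↦ mul_nonneg)
    fun u _ ↦ nestingFactor_nonneg h𝔠 hr hL hLM hP hN u

/-- … and so is the loop functional `A_𝔠(c)` of EVERY configuration. -/
theorem nestingWeight_nonneg (hr : ∀ i, 0 < r i) (hL : 0 < L) (hLM : L < M)
    (hP : ∑ i, max (a i) 0 + max (-∑ i, a i) 0 ≤ π / 6)
    (hN : ∑ i, max (-a i) 0 + max (∑ i, a i) 0 ≤ 5 * π / 6) (c : LoopConfig ℂ) :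
    0 ≤ c.nestingWeight 𝔠.density :=
  finprod_mem_nonneg h𝔠 hr hL hLM hP hN c.loops

omit h𝔠 in
/-- `P ≤ Σ_i |a_i|`: the total positive charge is at most the total absolute charge … -/
theorem sum_max_add_max_neg_sum_le (b : Fin n → ℝ) :
    ∑ i, max (b i) 0 + max (-∑ i, b i) 0 ≤ ∑ i, |b i| := by
  rcases le_or_gt 0 (∑ i, b i) with hs | hs
  · rw [max_eq_right (neg_nonpos.2 hs), add_zero]
    exact Finset.sum_le_sum fun i _ ↦ max_le (le_abs_self _) (abs_nonneg _)
  · rw [max_eq_left (neg_nonneg.2 hs.le), ← sub_eq_add_neg, ← Finset.sum_sub_distrib]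
    refine Finset.sum_le_sum fun i _ ↦ ?_
    rcases le_or_gt 0 (b i) with h | h
    · rw [max_eq_left h, sub_self]; exact abs_nonneg _
    · rw [max_eq_right h.le, zero_sub]; exact neg_le_abs _

omit h𝔠 in
/-- … and so is the total negative charge `N`. -/
theorem sum_max_neg_add_max_sum_le (b : Fin n → ℝ) :
    ∑ i, max (-b i) 0 + max (∑ i, b i) 0 ≤ ∑ i, |b i| := by
  simpa only [Finset.sum_neg_distrib, neg_neg, abs_neg] using sum_max_add_max_neg_sum_le fun i ↦ -b i

/-- **Cone positivity of the fusion cloud**: total absolute charge `Σ_i |a_i| ≤ π/6` makes every loop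
weight `≥ 0` (an open set of charge vectors on which the tilted multi-disc moments are honest) … -/
theorem nestingFactor_nonneg_of_sum_abs_le (hr : ∀ i, 0 < r i) (hL : 0 < L) (hLM : L < M)
    (ha : ∑ i, |a i| ≤ π / 6) (u : UnbasedLoop ℂ) : 0 ≤ u.nestingFactor 𝔠.density :=
  nestingFactor_nonneg h𝔠 hr hL hLM ((sum_max_add_max_neg_sum_le a).trans ha)
    ((sum_max_neg_add_max_sum_le a).trans (ha.trans (by linarith [Real.pi_pos]))) u

/-- … and the loop functional of every configuration `≥ 0`. -/
theorem nestingWeight_nonneg_of_sum_abs_le (hr : ∀ i, 0 < r i) (hL : 0 < L) (hLM : L < M)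
    (ha : ∑ i, |a i| ≤ π / 6) (c : LoopConfig ℂ) : 0 ≤ c.nestingWeight 𝔠.density :=
  nestingWeight_nonneg h𝔠 hr hL hLM ((sum_max_add_max_neg_sum_le a).trans ha)
    ((sum_max_neg_add_max_sum_le a).trans (ha.trans (by linarith [Real.pi_pos]))) c

end Fusion

/-! ## §5 Pattern counts on both lattice ensembles: finiteness, a deterministic bound, integrability -/

/-- Loops of the window `B(0, R)` meet the closed ball `B̄(0, R)`. -/
theorem patternLoops_subset_meeting (c : LoopConfig ℂ) {n : ℕ} (z : Fin n → ℂ) (r : Fin n → ℝ)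
    (R : ℝ) (S : Finset (Fin n)) :
    {u ∈ c.loops | u.range ⊆ ball (0 : ℂ) R ∧
      (∀ i ∈ S, closedBall (z i) (r i) ⊆ {w | u.wind w ≠ 0}) ∧
      ∀ i, i ∉ S → Disjoint (closedBall (z i) (r i)) ({w | u.wind w ≠ 0} ∪ u.range)} ⊆
      {u ∈ c.loops | (u.range ∩ closedBall (0 : ℂ) R).Nonempty} := fun u hu ↦ ⟨hu.1, by
  obtain ⟨p, hp⟩ := u.range_nonempty
  exact ⟨p, hp, ball_subset_closedBall (hu.2.1 hp)⟩⟩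

/-- **The pattern counts are deterministically bounded on both lattices**: `N_S(ω) ≤ N(δ)` at mesh `δ > 0`. -/
theorem exists_patternCount_le : ∀ E ∈ latticeEnsembles, ∀ {δ : ℝ}, 0 < δ → ∀ {n : ℕ}
    (z : Fin n → ℂ) (r : Fin n → ℝ) (R : ℝ),
    ∃ N : ℕ, ∀ (ω : E.Ω) (S : Finset (Fin n)), patternCount (E.X δ ω) z r R S ≤ N := by
  intro E hE δ hδ n z r R
  simp only [latticeEnsembles, Set.mem_insert_iff, Set.mem_singleton_iff] at hE
  rcases hE with rfl | rfl
  · exact ⟨_, fun ω S ↦ (Set.ncard_le_ncard (patternLoops_subset_meeting _ z r R S)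
      (ncard_loops_meeting_le hδ _ ω).1).trans (ncard_loops_meeting_le hδ R ω).2⟩
  · exact ⟨_, fun ω S ↦ (Set.ncard_le_ncard (patternLoops_subset_meeting _ z r R S)
      (ncard_loops_siteLoopConfig_meeting_le hδ _ ω).1).trans
        (ncard_loops_siteLoopConfig_meeting_le hδ R ω).2⟩

/-- **The tilted pattern moment is an honest integral for ALL weights `u_S ≥ 0` on both lattices** at
every mesh `δ > 0` (measurable counts, deterministic bound, probability law; fusion needs `w_S > 1`). -/
theorem integrable_prod_pow_patternCount : ∀ E ∈ latticeEnsembles, ∀ {δ : ℝ}, 0 < δ → ∀ {n : ℕ}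
    (z : Fin n → ℂ) (r : Fin n → ℝ) (R : ℝ) (u : Finset (Fin n) → ℝ), (∀ S, 0 ≤ u S) →
    Integrable (fun ω ↦ ∏ S ∈ nonemptyParts n, u S ^ patternCount (E.X δ ω) z r R S) E.P := by
  intro E hE δ hδ n z r R u hu
  haveI := isProbabilityMeasure_of_mem hE
  obtain ⟨N, hN⟩ := exists_patternCount_le E hE hδ z r R
  refine Integrable.of_bound (Finset.measurable_prod _ fun S _ ↦
    (measurable_patternCount E hE δ z r R S).const_pow (u S)).aestronglyMeasurable
    (∏ S ∈ nonemptyParts n, max 1 (u S) ^ N) (Eventually.of_forall fun ω ↦ ?_)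
  rw [Real.norm_eq_abs, Finset.abs_prod]
  refine Finset.prod_le_prod (fun S _ ↦ abs_nonneg _) fun S _ ↦ ?_
  rw [abs_of_nonneg (pow_nonneg (hu S) _)]
  exact (pow_le_pow_left₀ (hu S) (le_max_right 1 (u S)) _).trans
    (pow_le_pow_right₀ (le_max_left 1 (u S)) (hN ω S))

end FusionCloud

/-- **Pattern decomposition of the fusion functional on BOTH lattice ensembles** (registered helper
toward stub R5' `stub_fusionTilt`, line `ring-cloud-tomography` r4): for `E ∈ latticeEnsembles`, mesh
`δ > 0`, sample `ω`, discs `B̄(z i, r i)` of charges `a i` in the hole of the ring `(0, L, M)` of charge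
`−Σ a i` (`0 < r i`, `‖z i‖ + r i ≤ L`, `0 < L < M`), the loop functional of the fusion cloud is EXACTLY
`(∏_{S ≠ ∅} magicWeight(Σ_{i∈S} a_i)^{patternCount · z r L S}) · ∏ᶠ_{u not a pattern loop of B(0,L)} w_u`
(second factor `≥ 0` under the charge bounds of `FusionCloud.finprod_mem_nonneg`). -/
theorem nestingWeight_fusionCloud_eq_latticeEnsembles : ∀ E ∈ latticeEnsembles, ∀ {δ : ℝ}, 0 < δ →
    ∀ (ω : E.Ω) {n : ℕ} (z : Fin n → ℂ) (r a : Fin n → ℝ) {L M : ℝ}, (∀ i, 0 < r i) →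
    (∀ i, ‖z i‖ + r i ≤ L) → 0 < L → L < M →
    (E.X δ ω).nestingWeight (Cloud.mk n 1 z r a (fun _ ↦ 0) (fun _ ↦ L) (fun _ ↦ M)
      (fun _ ↦ -∑ i, a i)).density =
      (∏ S ∈ nonemptyParts n, magicWeight (∑ i ∈ S, a i) ^ patternCount (E.X δ ω) z r L S) *
        ∏ᶠ u ∈ (E.X δ ω).loops \ {u ∈ (E.X δ ω).loops | u.range ⊆ Metric.ball (0 : ℂ) L ∧
            ∀ i, Metric.closedBall (z i) (r i) ⊆ {w | u.wind w ≠ 0} ∨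
              Disjoint (Metric.closedBall (z i) (r i)) ({w | u.wind w ≠ 0} ∪ u.range)},
          u.nestingFactor (Cloud.mk n 1 z r a (fun _ ↦ 0) (fun _ ↦ L) (fun _ ↦ M)
            (fun _ ↦ -∑ i, a i)).density :=
  fun E hE _ hδ ω _ _ _ _ _ M hr hzL hL hLM ↦
    FusionCloud.nestingWeight_eq rfl hr hzL hL hLM (ConeTilt.finite_loops_meeting E hE hδ ω M)

end Summit.CriticalPhenomena.CardyFormulaZ2.Cruxes.NestingRigidity.RingCloudTomography

end
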